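import Summits.HodgeConjecture.HodgeConjecture.Theorems.MarkmanPartnerTransportOrphanKSCore
import Summits.HodgeConjecture.HodgeConjecture.Theorems.MarkmanPartnerTransportK3Sq2TypeHodgeOfCycleInducedGenerator
import Literature.AlgebraicGeometry.HodgeTheory.BettiCorrespondenceActionHodgeType
import Literature.AlgebraicGeometry.HodgeTheory.ComplexConjugationHolds
import Literature.AlgebraicGeometry.HodgeTheory.AlgebraicClassesHodgeTypeHolds
import Literature.AlgebraicGeometry.Hyperkaehler.IrreducibleSymplecticOfDeformationType
import HarnessLib

/-!
# Orphan levers, T1 «ORPH-KS»: HC⁴ for `K3^{[2]}`-type fourfolds with real quadratic endomorphism field, modulo Kuga–Satake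

Sub-problem `HodgeConjecture`, route MarkmanPartnerTransport, rung «ORPHAN-RM, real quadratic» (memo ROUTE-P1AJ,
target T1 of `Sketch_P1AJ_OrphanLevers_g37`, cell hodge-nonav). For a marked smooth projective `K3^{[2]}`-type
fourfold `(X, φ, P, z)` whose algebra of rational Hodge endomorphisms of `T(X)` (killing `N¹(X)`) is
`ℚ + ℚ θ` with `θ` rational, type-preserving, `q`-self-adjoint, of `q`-transcendental image and `θ² = d ≠ 0` on
`T(X)` — ANY Picard rank, with OR without a K3 partner — the Hodge conjecture holds in degree `4`, GRANTED the
Kuga–Satake Hodge conjecture for `X` and modulo the named facts {Verbitsky–Guan, O'Grady 2008, Charles–Markman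
2013, Varesco 2023 Cor. 4.6}.

Proof. By the core file (`exists_corrAction_eq_on_bbfTransc_of_kugaSatake`) `θ = [Z]_*` on `T(X)` for some
`Z ∈ A⁴(X × X) ⊗ ℂ`. §1 RATIONAL DESCENT (`exists_rational_corrAction_eq_on_bbfTransc`): `A⁴(X × X) ⊗ ℂ` is
spanned by RATIONAL algebraic classes, `Z = Σ cₖ Zₖ`; applying a `ℚ`-linear retraction `r : ℂ → ℚ` to the
rational coordinates of the identity `θ y = Σ cₖ [Zₖ]_* y` (`y` rational transcendental) shows that the rational
algebraic class `Z' = Σ r(cₖ) Zₖ` still has `[Z']_* = θ` on `T(X)` (which is spanned by its rational vectors).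
§2: `t = [Z']_*` is then a GLOBAL rational (`Z'` rational), type-preserving (`Z'` algebraic) cycle-induced
endomorphism equal to `θ` on `T(X)`, and F4 (`hodgeConjectureFor_of_cycleInducedGenerator_of_charlesMarkman`)
with generator `t` and the polynomials `a + c t` concludes.

CONDITIONAL on `IsKSCorrespondenceAlgebraicHK 2 _` (hypothesis, open in print for `K3^{[n]}`-type) and the four
named facts; credits nothing to the Hodge conjecture; the «ORPHAN-RM» cell stays open unconditionally.

References: M. Varesco, Math. Z. 305 (2023) Cor. 4.6, Rem. 5.5, Conj. 4.2; F. Charles, E. Markman, Compos. Math.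
149 (2013) Thm. 1.1; E. Markman, arXiv:2204.00516 Thm. 1.1; C. Voisin, *Hodge Theory II*, Lemma 11.41.
-/

noncomputable section

set_option linter.dupNamespace false

open Module CategoryTheory MonoidalCategory
open Literature.AlgebraicTopology.SingularHomology
open Literature.AlgebraicGeometry Literature.AlgebraicGeometry.Motives Literature.AlgebraicGeometry.HodgeTheory
open Literature.AlgebraicGeometry.Hyperkaehler Literature.AlgebraicGeometry.Surfaces
open Summit.HodgeConjecture.HodgeConjecture.Theorems.MarkmanPartnerTransport.PartnerLattice

namespace Summit.HodgeConjecture.HodgeConjecture.Theorems.MarkmanPartnerTransport.OrphanKS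

/-- `MarkedK3Sq[X, φ, P, z]`: VERBATIM the `let MarkedK3Sq := …` binder of the route declarations of
MarkmanPartnerTransport (clauses (m1)–(m6)). Local notation only. -/
local notation3 (prettyPrint := false) "MarkedK3Sq[" X ", " φ ", " P ", " z "]" =>
  (((IsIntegralClass P ∧ ∀ Q : complexBetti X (2 * 4), IsIntegralClass Q → ∃ n : ℤ, Q = n • P) ∧
    (∀ c : complexBetti X 2, IsIntegralClass c ↔ ∃ v : K3HilbertIndex → ℤ, φ c = fun i => (v i : ℂ)) ∧
    (∀ a : complexBetti X 2, cupPowTwo a 4 = ((3 : ℂ) * (k3HilbertForm 2 (φ a) (φ a)) ^ 2) • P) ∧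
    (IsOfHodgeType 4 X 2 2 0 (LinearEquiv.symm φ z) ∧
      ∀ τ : complexBetti X 2, IsOfHodgeType 4 X 2 2 0 τ → ∃ t : ℂ, τ = t • LinearEquiv.symm φ z) ∧
    (∀ c : complexBetti X 2, IsOfHodgeType 4 X 2 1 1 c ↔
      (k3HilbertForm 2 (φ c) z = 0 ∧ k3HilbertForm 2 (φ c) (star z) = 0)) ∧
    (k3HilbertForm 2 z z = 0 ∧ 0 < (k3HilbertForm 2 (star z) z).re)))

/-- `qQ` = the rational Beauville–Bogomolov form of `K3^{[2]}`-type on `ℚ²³` (as in `…PartnerExistenceLattice`). -/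
local notation3 (prettyPrint := false) "qQ" => Matrix.toBilin' (Matrix.map (k3HilbertGram 2) (Int.cast : ℤ → ℚ))

variable {X : SchemeOver ℂ} {φ : complexBetti X 2 ≃ₗ[ℂ] (K3HilbertIndex → ℂ)} {P : complexBetti X (2 * 4)}
  {z : K3HilbertIndex → ℂ}

/-! ### §1 Rational descent of a correspondence that is rational on `T(X)` -/

/-- **Rational descent.** If an endomorphism `θ` of `H²(X(ℂ); ℂ)` preserving rational classes agrees on the
`q`-transcendental space `T(X)` with the action `[Z]_*` of an algebraic class `Z ∈ A⁴(X × X) ⊗ ℂ`, then it agrees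
there with `[Z']_*` for a RATIONAL algebraic class `Z'`: write `Z = Σ cₖ Zₖ` with `Zₖ` rational algebraic
(`supportedClasses_eq_span_isRationalClass`), choose a `ℚ`-linear retraction `r : ℂ → ℚ` and put `Z' = Σ r(cₖ) Zₖ`;
for rational transcendental `y` the rational coordinate vectors of `θ y` and `[Zₖ]_* y` satisfy
`θ y = Σ cₖ [Zₖ]_* y`, and applying `r` coordinatewise gives `θ y = Σ r(cₖ) [Zₖ]_* y = [Z']_* y`; `T(X)` is spanned
by its rational vectors (`mem_span_ratTransc_iff`). [cite: VoisinHodgeI2002, §7.1.1 and §11.3.3 Lemma 11.41]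
[cite: Huybrechts2016K3, Ch. 3 Lemma 3.1] -/
theorem exists_rational_corrAction_eq_on_bbfTransc (hX : IsSmoothProjective 4 X) (hM : MarkedK3Sq[X, φ, P, z])
    (θ : complexBetti X 2 →ₗ[ℂ] complexBetti X 2) (h1 : ∀ y, IsRationalClass y → IsRationalClass (θ y))
    {Z : complexBetti (X ⊗ X) (2 * 4)} (hZ : Z ∈ algebraicClasses (X ⊗ X) 4)
    (hZθ : ∀ y : complexBetti X 2,
      (∀ e : complexBetti X 2, e ∈ algebraicClasses X 1 → k3HilbertForm 2 (φ y) (φ e) = 0) →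
      corrAction complexOrientationFamily hX hX (rfl : 2 + 2 * 4 = 2 + 2 * 4) Z y = θ y) :
    ∃ Z' ∈ algebraicClasses (X ⊗ X) 4, IsRationalClass Z' ∧ ∀ y : complexBetti X 2,
      (∀ e : complexBetti X 2, e ∈ algebraicClasses X 1 → k3HilbertForm 2 (φ y) (φ e) = 0) →
      corrAction complexOrientationFamily hX hX (rfl : 2 + 2 * 4 = 2 + 2 * 4) Z' y = θ y := by
  classical
  obtain ⟨-, hint, -⟩ := id hM
  obtain ⟨NQ, hNQ⟩ := exists_ratNeronSeveri (X := X) φ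
  have hXX : IsSmoothProjective (4 + 4) (X ⊗ X) := hX.tensor_holds hX
  set A := corrAction complexOrientationFamily hX hX (rfl : 2 + 2 * 4 = 2 + 2 * 4) with hA
  -- `Z` is a `ℂ`-combination of rational algebraic classes
  have hspan := supportedClasses_eq_span_isRationalClass hXX (2 * 4) 4
  change algebraicClasses (X ⊗ X) 4 = Submodule.span ℂ
    {c : complexBetti (X ⊗ X) (2 * 4) | IsRationalClass c ∧ c ∈ algebraicClasses (X ⊗ X) 4} at hspan
  have hZ' := hZ
  rw [hspan, Submodule.mem_span_set'] at hZ'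
  obtain ⟨n, c, g, hsum⟩ := hZ'
  -- a `ℚ`-linear retraction `r : ℂ → ℚ` of the inclusion `ℚ ⊂ ℂ`
  obtain ⟨r, hr⟩ := (Algebra.linearMap ℚ ℂ).exists_leftInverse_of_injective
    (LinearMap.ker_eq_bot.2 (algebraMap ℚ ℂ).injective)
  have hrq : ∀ q : ℚ, r (q : ℂ) = q := fun q => by
    have h := LinearMap.congr_fun hr q
    rw [LinearMap.comp_apply, Algebra.linearMap_apply, eq_ratCast, LinearMap.id_apply] at h
    exact h
  have hrmul : ∀ (x : ℂ) (q : ℚ), r (x * (q : ℂ)) = q * r x := fun x q => by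
    rw [mul_comm, ← Rat.smul_def, map_smul, smul_eq_mul]
  -- the rational class `Z' = Σ r(cₖ) Zₖ`
  refine ⟨∑ i, ((r (c i) : ℚ) : ℂ) • (g i : complexBetti (X ⊗ X) (2 * 4)), ?_, ?_, ?_⟩
  · exact Submodule.sum_mem _ fun i _ => Submodule.smul_mem _ _ (g i).2.2
  · exact Finset.sum_induction _ (fun x => IsRationalClass x) (fun a b ha hb => ha.add hb) IsRationalClass.zero
      (fun i _ => (g i).2.1.smul (r (c i)))
  · -- the KEY identity on RATIONAL transcendental classes
    have hrat : ∀ u : complexBetti X 2, IsRationalClass u →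
        (∀ e : complexBetti X 2, e ∈ algebraicClasses X 1 → k3HilbertForm 2 (φ u) (φ e) = 0) →
        A (∑ i, ((r (c i) : ℚ) : ℂ) • (g i : complexBetti (X ⊗ X) (2 * 4))) u = θ u := by
      intro u hu huT
      -- rational coordinates of `θ u` and of the `[Zₖ]_* u`
      obtain ⟨w₀, hw₀⟩ := (isRationalClass_iff_of_markedSq hX hint (θ u)).1 (h1 u hu)
      have hwi : ∀ i, ∃ w : K3HilbertIndex → ℚ,
          φ (A (g i : complexBetti (X ⊗ X) (2 * 4)) u) = fun j => (w j : ℂ) := fun i =>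
        (isRationalClass_iff_of_markedSq hX hint _).1
          (isRationalClass_corrAction_complexOrientationFamily hX hX _ (g i).2.1 hu)
      choose w hw using hwi
      -- `θ u = Σ cₖ [Zₖ]_* u`, in coordinates
      have hθu : θ u = ∑ i, c i • A (g i : complexBetti (X ⊗ X) (2 * 4)) u := by
        rw [← hZθ u huT, ← hsum, map_sum, LinearMap.sum_apply]
        refine Finset.sum_congr rfl fun i _ => ?_
        rw [map_smul, LinearMap.smul_apply]
      have hcoord : ∀ j, (w₀ j : ℂ) = ∑ i, c i * (w i j : ℂ) := by
        intro j
        have h := congrArg (fun v : complexBetti X 2 => φ v j) hθu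
        simp only [map_sum, map_smul, Finset.sum_apply, Pi.smul_apply, smul_eq_mul] at h
        rw [hw₀] at h
        simp only [hw] at h
        exact h
      -- apply the retraction `r`
      have hcoordQ : ∀ j, w₀ j = ∑ i, w i j * r (c i) := by
        intro j
        have h := congrArg r (hcoord j)
        rw [hrq, map_sum] at h
        rw [h]
        exact Finset.sum_congr rfl fun i _ => hrmul (c i) (w i j)
      -- compare through the marking
      apply φ.injective
      rw [hw₀, map_sum, LinearMap.sum_apply, map_sum]
      funext j
      rw [Finset.sum_apply, hcoordQ j, Rat.cast_sum]
      refine Finset.sum_congr rfl fun i _ => ?_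
      rw [map_smul, LinearMap.smul_apply, map_smul, hw i]
      simp only [Pi.smul_apply, smul_eq_mul, Rat.cast_mul]
      ring
    -- extend to all of `T(X) = T_ℚ ⊗ ℂ` by linearity
    intro y hy
    have hφy : φ y ∈ Submodule.span ℂ ((fun a : K3HilbertIndex → ℚ => fun i => (a i : ℂ)) ''
        ((qQ).orthogonal NQ : Set (K3HilbertIndex → ℚ))) :=
      (mem_span_ratTransc_iff hX hint hNQ (φ y)).2 hy
    have key : ∀ v ∈ Submodule.span ℂ ((fun a : K3HilbertIndex → ℚ => fun i => (a i : ℂ)) ''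
        ((qQ).orthogonal NQ : Set (K3HilbertIndex → ℚ))),
        A (∑ i, ((r (c i) : ℚ) : ℂ) • (g i : complexBetti (X ⊗ X) (2 * 4))) (φ.symm v) = θ (φ.symm v) := by
      intro v hv
      refine Submodule.span_induction (p := fun v _ =>
        A (∑ i, ((r (c i) : ℚ) : ℂ) • (g i : complexBetti (X ⊗ X) (2 * 4))) (φ.symm v) = θ (φ.symm v))
        ?_ ?_ ?_ ?_ hv
      · rintro _ ⟨a, ha, rfl⟩
        refine hrat _ ((isRationalClass_iff_of_markedSq hX hint _).2 ⟨a, by rw [LinearEquiv.apply_symm_apply]⟩)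
          fun e he => ?_
        rw [LinearEquiv.apply_symm_apply]
        exact (ratCast_bbfTransc_iff_mem_orthogonal hX hint hNQ a).2 ha e he
      · simp only [map_zero]
      · intro u v _ _ hu hv
        rw [map_add, map_add, map_add, hu, hv]
      · intro t u _ hu
        rw [map_smul, map_smul, map_smul, hu]
    have h := key (φ y) hφy
    rwa [LinearEquiv.symm_apply_apply] at h

/-! ### §2 T1 «ORPH-KS» -/

/-- **T1 «ORPH-KS»: HC⁴(X) for a marked smooth projective `K3^{[2]}`-type fourfold with real quadratic
transcendental endomorphism field `E(X) = ℚ(θ)`, `θ² = d`, modulo the Kuga–Satake Hodge conjecture for `X`.**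
Hypotheses: the route's facts {Verbitsky–Guan, O'Grady, Charles–Markman} and Varesco 2023 Cor. 4.6 BY NAME; the
marking (m1)–(m6); `X` projective irreducible symplectic with `IsKSCorrespondenceAlgebraicHK 2` (the AV-sector
INPUT, open in print); `θ` rational (h1), type-preserving (h2), with `q`-transcendental image (h4), `q`-self-adjoint
(h5), `θ² = d ≠ 0` on `T(X)` (hθθ), and generating: every rational Hodge endomorphism killing `N¹(X)` with
transcendental image is `a + c θ` on `T(X)` (hgen; so `E(X) ⊆ ℚ(θ)`, real quadratic when `d` is not a square). ANY
Picard rank, partnered OR orphan (`θ` need not kill `N¹(X)` — that binder of the sketch is not used). Proof: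
core (`θ = [Z]_*` on `T(X)`, Varesco) → rational descent (`Z'` rational) → F4 with the cycle-induced generator
`t = [Z']_*` and polynomials `a + c t`. CONDITIONAL; credits nothing to the Hodge conjecture.
[cite: Varesco2023, Cor. 4.6, Rem. 5.5 and Conj. 4.2] [cite: CharlesMarkman2013, Thm. 1.1 (§1)]
[cite: Markman2024, §1.1 Thm. 1.1] [cite: VoisinHodgeI2002, §11.3.3 Lemma 11.41] -/
theorem hodgeConjectureFor_of_quadraticEndomorphismField_of_kugaSatake
    (hV : VerbitskyGuan_cohomology_K3HilbertSquareType) (hO : OGrady2008_dualBBFClass_algebraic)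
    (hB : CharlesMarkman2013_lefschetzStandard_K3HilbertType)
    (hVar : Varesco2023_transcendentalHodgeSimilitude_algebraic_of_lefschetzStandard)
    (hX : IsSmoothProjective 4 X) (hK : IsOfK3HilbertSquareType X) (hM : MarkedK3Sq[X, φ, P, z])
    (hIS : IsProjectiveIrreducibleSymplectic (2 * 2) X) (hKS : IsKSCorrespondenceAlgebraicHK 2 hIS.1)
    (θ : complexBetti X 2 →ₗ[ℂ] complexBetti X 2)
    (h1 : ∀ y, IsRationalClass y → IsRationalClass (θ y))
    (h2 : ∀ (i j : ℕ) y, IsOfHodgeType 4 X 2 i j y → IsOfHodgeType 4 X 2 i j (θ y))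
    (h4 : ∀ y : complexBetti X 2, ∀ d : complexBetti X 2, d ∈ algebraicClasses X 1 →
      k3HilbertForm 2 (φ (θ y)) (φ d) = 0)
    (h5 : ∀ y w : complexBetti X 2, k3HilbertForm 2 (φ (θ y)) (φ w) = k3HilbertForm 2 (φ y) (φ (θ w)))
    (d : ℚ) (hd : d ≠ 0)
    (hθθ : ∀ y : complexBetti X 2,
      (∀ e : complexBetti X 2, e ∈ algebraicClasses X 1 → k3HilbertForm 2 (φ y) (φ e) = 0) →
      θ (θ y) = (d : ℂ) • y)
    (hgen : ∀ f : complexBetti X 2 →ₗ[ℂ] complexBetti X 2, (∀ y, IsRationalClass y → IsRationalClass (f y)) →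
      (∀ (i j : ℕ) y, IsOfHodgeType 4 X 2 i j y → IsOfHodgeType 4 X 2 i j (f y)) →
      (∀ e : complexBetti X 2, e ∈ algebraicClasses X 1 → f e = 0) →
      (∀ y : complexBetti X 2, ∀ e : complexBetti X 2, e ∈ algebraicClasses X 1 →
        k3HilbertForm 2 (φ (f y)) (φ e) = 0) →
      ∃ a c : ℚ, ∀ y : complexBetti X 2,
        (∀ e : complexBetti X 2, e ∈ algebraicClasses X 1 → k3HilbertForm 2 (φ y) (φ e) = 0) →
        f y = (a : ℂ) • y + (c : ℂ) • θ y) :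
    HodgeConjectureFor 4 X := by
  classical
  obtain ⟨Z, hZ, hZθ⟩ := exists_corrAction_eq_on_bbfTransc_of_kugaSatake hB hVar hX hK hM hIS hKS θ h1 h2 h4 h5
    d hd hθθ
  obtain ⟨Z', hZ', hZ'rat, hZ'θ⟩ := exists_rational_corrAction_eq_on_bbfTransc hX hM θ h1 hZ hZθ
  have hXX : IsSmoothProjective (4 + 4) (X ⊗ X) := hX.tensor_holds hX
  refine hodgeConjectureFor_of_cycleInducedGenerator_of_charlesMarkman hV hO hB hX hK hM
    (corrAction complexOrientationFamily hX hX (rfl : 2 + 2 * 4 = 2 + 2 * 4) Z') ?_ ?_ ⟨Z', hZ', fun y => rfl⟩ ?_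
  · intro y hy
    exact isRationalClass_corrAction_complexOrientationFamily hX hX _ hZ'rat hy
  · intro a b y hy
    exact isOfHodgeType_corrAction_of_type_self complexOrientationFamily exists_isReal_hodgeModel_holds hX hX _
      (isOfHodgeType_of_mem_algebraicClasses_of_isSmoothProjective hXX 4 hZ') rfl rfl hy
  · intro f hf1 hf2 hf3 hf4
    obtain ⟨a, c, hac⟩ := hgen f hf1 hf2 hf3 hf4
    refine ⟨2, ![a, c], fun y hy => ?_⟩
    rw [hac y hy, Fin.sum_univ_two]
    simp only [Matrix.cons_val_zero, Matrix.cons_val_one, Fin.val_zero, Fin.val_one, pow_zero, pow_one,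
      Module.End.one_apply, hZ'θ y hy]

/-- **T1 «ORPH-KS» over the route's own binders** (signature upgrade asked by the planner, p1 g37): as
`hodgeConjectureFor_of_quadraticEndomorphismField_of_kugaSatake`, with «`X` projective irreducible symplectic»
supplied BY NAME from `K3^{[2]}`-type (`Beauville1983_irreducibleSymplectic_of_k3HilbertType`) and the ONE
conditional input stated directly on `hX` as `IsKSCorrespondenceAlgebraicHK 2 hX` (Kuga–Satake Hodge conjecture
for `X`, open in print). HC⁴(X) for every marked smooth projective `K3^{[2]}`-type `X` with `E(X) = ℚ(θ)` real
quadratic (any `ρ`, partnered or orphan), CONDITIONAL on KSHC(X), modulo the five named facts {Verbitsky–Guan,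
O'Grady 2008, Charles–Markman 2013, Varesco 2023 Cor. 4.6, Beauville 1983}. Credits nothing to the Hodge
conjecture. [cite: Varesco2023, Cor. 4.6 and Conj. 4.2] [cite: Beauville1983, §6 Théorème 3, §8 Prop. 9]
[cite: CharlesMarkman2013, Thm. 1.1 (§1)] -/
theorem hodgeConjectureFor_of_quadraticEndomorphismField_of_KSHC
    (hV : VerbitskyGuan_cohomology_K3HilbertSquareType) (hO : OGrady2008_dualBBFClass_algebraic)
    (hB : CharlesMarkman2013_lefschetzStandard_K3HilbertType)
    (hVar : Varesco2023_transcendentalHodgeSimilitude_algebraic_of_lefschetzStandard)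
    (hBea : Beauville1983_irreducibleSymplectic_of_k3HilbertType)
    (hX : IsSmoothProjective 4 X) (hK : IsOfK3HilbertSquareType X) (hM : MarkedK3Sq[X, φ, P, z])
    (hKS : IsKSCorrespondenceAlgebraicHK 2 hX)
    (θ : complexBetti X 2 →ₗ[ℂ] complexBetti X 2)
    (h1 : ∀ y, IsRationalClass y → IsRationalClass (θ y))
    (h2 : ∀ (i j : ℕ) y, IsOfHodgeType 4 X 2 i j y → IsOfHodgeType 4 X 2 i j (θ y))
    (h4 : ∀ y : complexBetti X 2, ∀ d : complexBetti X 2, d ∈ algebraicClasses X 1 →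
      k3HilbertForm 2 (φ (θ y)) (φ d) = 0)
    (h5 : ∀ y w : complexBetti X 2, k3HilbertForm 2 (φ (θ y)) (φ w) = k3HilbertForm 2 (φ y) (φ (θ w)))
    (d : ℚ) (hd : d ≠ 0)
    (hθθ : ∀ y : complexBetti X 2,
      (∀ e : complexBetti X 2, e ∈ algebraicClasses X 1 → k3HilbertForm 2 (φ y) (φ e) = 0) →
      θ (θ y) = (d : ℂ) • y)
    (hgen : ∀ f : complexBetti X 2 →ₗ[ℂ] complexBetti X 2, (∀ y, IsRationalClass y → IsRationalClass (f y)) →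
      (∀ (i j : ℕ) y, IsOfHodgeType 4 X 2 i j y → IsOfHodgeType 4 X 2 i j (f y)) →
      (∀ e : complexBetti X 2, e ∈ algebraicClasses X 1 → f e = 0) →
      (∀ y : complexBetti X 2, ∀ e : complexBetti X 2, e ∈ algebraicClasses X 1 →
        k3HilbertForm 2 (φ (f y)) (φ e) = 0) →
      ∃ a c : ℚ, ∀ y : complexBetti X 2,
        (∀ e : complexBetti X 2, e ∈ algebraicClasses X 1 → k3HilbertForm 2 (φ y) (φ e) = 0) →
        f y = (a : ℂ) • y + (c : ℂ) • θ y) :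
    HodgeConjectureFor 4 X := by
  have hIS : IsProjectiveIrreducibleSymplectic (2 * 2) X := hBea 2 (by norm_num) hX hK
  exact hodgeConjectureFor_of_quadraticEndomorphismField_of_kugaSatake hV hO hB hVar hX hK hM hIS hKS θ h1 h2 h4
    h5 d hd hθθ hgen

end Summit.HodgeConjecture.HodgeConjecture.Theorems.MarkmanPartnerTransport.OrphanKS

end
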